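import Literature.Probability.RandomPlanarGeometry.KestenTwoSidedSAW
import Mathlib.Probability.Martingale.Convergence
import HarnessLib

/-!
# The continuation kernel of a two-sided SAW law as the limit of finite-memory conditionals

Topic `Literature/Probability/RandomPlanarGeometry`, companion of `KestenTwoSidedSAW.lean`
(definition request `defn-KestenTwoSidedSAW`, route `SAWTipEnvironment`): there the one-step
**continuation kernel** `continuationKernel μ` of a measure `μ` on bi-infinite lattice paths
`ℤ → ℤ²` is defined as the regular conditional distribution of the next vertex `ω 1` given the
infinite past `past ω = (ω 0, ω (-1), …)` (Mathlib `condDistrib`), and the finite-memory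
continuation probabilities `μ[· | pastCyl m η]` are shown to be ratio limits of finite-volume
pattern frequencies whenever those converge (`tendsto_div_cond`,
`IsUniformLocalLimit.tendsto_cond_pastCyl`). This file closes the loop between the two:

* `pastFiltration` — the natural filtration `ℱ m = σ(ω 0, …, ω (-m))` of the past
  (Mathlib `Filtration.natural`), `pastWindow m` (the finite past as one random variable),
  `pastFiltration_eq_comap`, `preimage_pastWindow_singleton` (the atoms of `ℱ m` are the
  cylinders `pastCyl m (past ω)`), `iSup_pastFiltration : ⨆ m, ℱ m = σ(past)`;
* `ae_tendsto_condExp_pastFiltration` — **Lévy's upward theorem** (Mathlib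
  `tendsto_ae_condExp`) for the kernel: `μ[𝟙{ω 1 ∈ B} | ℱ m] → p_μ(past ω)(B)` a.s.;
* `condExp_pastFiltration_ae_eq_cond` — on the atoms of the countably generated `ℱ m` the
  conditional expectation is the elementary ratio `μ (E_m(ω) ∩ {ω 1 ∈ B}) / μ (E_m(ω))`
  (Mathlib `condDistrib_apply_of_ne_zero`; a.e. atom has positive mass,
  `ae_map_apply_singleton_ne_zero`);
* **`ae_tendsto_cond_pastCyl`**, `ae_tendsto_cond_pastCyl_stepProb` — consequently
  `p_μ(s | past ω) = lim_{m → ∞} μ[ω' 1 = s | ω' = ω on [-m, 0]]` for `μ`-a.e. `ω`: the tip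
  kernel on the infinite past IS the limit of Lawler–Schramm–Werner's finite-past transition
  probabilities `Q(ω ⊕ s)/Q(ω)` (LSW 2004, §3.4.6), the API asked for by the route.

* `admissible η` — the admissible continuations of a past (lattice neighbours of the root
  not visited by the past) and `KestenTwoSidedSAW.ae_continuationKernel_admissible`: under
  hypotheses (a)–(b) of `KestenTwoSidedSAW μ` the kernel `p_μ(past ω)` is a.s. carried by the
  admissible continuations (nearest-neighbour steps and self-avoidance pass to the kernel, by
  disintegration `μ.map (past, ω 1) = (μ.map past) ⊗ₘ p_μ`).

Everything here is proved (no named facts); apart from the last statement it is pure measure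
theory on the path space, valid for every finite measure `μ`.

## References

* G. F. Lawler, O. Schramm, W. Werner, *On the scaling limit of planar self-avoiding walk*,
  Proc. Sympos. Pure Math. 72 (2004), arXiv:math/0204277, §3.4.6 (`Q(ω) = Σ Q(ω ⊕ ω')`, the
  infinite SAW as the process with these transition probabilities).
* D. Williams, *Probability with Martingales*, CUP (1991), §14.2 (Lévy's upward theorem) — via
  Mathlib `MeasureTheory.tendsto_ae_condExp`.
-/

noncomputable section

open MeasureTheory ProbabilityTheory Filter Set Function
open _root_.Topology
open Literature.Probability.LatticeModels
open scoped ENNReal NNReal BigOperators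

namespace Literature.Probability.RandomPlanarGeometry.SAW

/-! ### The continuation kernel as the limit of finite-memory continuation probabilities -/

/-- The **natural filtration of the past**: `ℱ m = σ(ω 0, ω (-1), …, ω (-m))`
(Mathlib `Filtration.natural` of the process `j ↦ ω (-j)`). [folklore] -/
def pastFiltration : Filtration ℕ (MeasurableSpace.pi : MeasurableSpace (ℤ → Site 2)) :=
  Filtration.natural (fun (j : ℕ) (ω : ℤ → Site 2) => ω (-(j : ℤ)))
    fun j => (measurable_pi_apply (-(j : ℤ))).stronglyMeasurable

/-- The finite past window `(ω (-j))_{j ≤ m}` as one random variable. [folklore] -/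
def pastWindow (m : ℕ) (ω : ℤ → Site 2) : Set.Iic m → Site 2 := fun j => ω (-((j : ℕ) : ℤ))

/-- `pastWindow m` is measurable. [folklore] -/
theorem measurable_pastWindow (m : ℕ) : Measurable (pastWindow m) :=
  measurable_pi_lambda _ fun j => measurable_pi_apply (-((j : ℕ) : ℤ))

/-- `ℱ m` is generated by the finite past window. [folklore] -/
theorem pastFiltration_eq_comap (m : ℕ) :
    (pastFiltration m : MeasurableSpace (ℤ → Site 2)) =
      MeasurableSpace.comap (pastWindow m) inferInstance :=
  Filtration.natural_eq_comap _ _ m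

/-- The atoms of `ℱ m` are the finite-past cylinders:
`(pastWindow m)⁻¹ {pastWindow m ω} = pastCyl m (past ω)`. [folklore] -/
theorem preimage_pastWindow_singleton (m : ℕ) (ω : ℤ → Site 2) :
    pastWindow m ⁻¹' {pastWindow m ω} = pastCyl m (past ω) := by
  ext ω'
  simp only [mem_preimage, mem_singleton_iff, pastCyl, mem_setOf_eq, past_apply]
  constructor
  · intro h j hj
    exact congrFun h ⟨j, Set.mem_Iic.mpr hj⟩
  · intro h
    funext j
    exact h j (Set.mem_Iic.mp j.2)

/-- The join of the past filtration is the σ-algebra of the whole past: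
`⨆ m, ℱ m = σ(past)`. [folklore] -/
theorem iSup_pastFiltration :
    (⨆ m, (pastFiltration m : MeasurableSpace (ℤ → Site 2))) =
      MeasurableSpace.comap past inferInstance := by
  apply le_antisymm
  · refine iSup_le fun m => ?_
    change (⨆ j ≤ m,
      MeasurableSpace.comap (fun ω : ℤ → Site 2 => ω (-(j : ℤ))) inferInstance) ≤ _
    refine iSup₂_le fun j _ => ?_
    have : (fun ω : ℤ → Site 2 => ω (-(j : ℤ))) = (fun p : ℕ → Site 2 => p j) ∘ past := rfl
    rw [this, ← MeasurableSpace.comap_comp]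
    exact MeasurableSpace.comap_mono (measurable_pi_apply j).comap_le
  · change MeasurableSpace.comap past MeasurableSpace.pi ≤ _
    rw [MeasurableSpace.pi, MeasurableSpace.comap_iSup]
    refine iSup_le fun j => ?_
    rw [MeasurableSpace.comap_comp]
    refine le_trans ?_ (le_iSup (fun m => (pastFiltration m : MeasurableSpace (ℤ → Site 2))) j)
    change MeasurableSpace.comap (fun ω : ℤ → Site 2 => ω (-(j : ℤ))) inferInstance ≤
      (⨆ i ≤ j, MeasurableSpace.comap (fun ω : ℤ → Site 2 => ω (-(i : ℤ))) inferInstance)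
    exact le_iSup₂ (f := fun i (_ : i ≤ j) =>
      MeasurableSpace.comap (fun ω : ℤ → Site 2 => ω (-(i : ℤ))) inferInstance) j le_rfl

/-- **Lévy's upward theorem for the continuation kernel**: for a measurable set `B` of sites,
the finite-memory conditional probabilities `μ[𝟙{ω 1 ∈ B} | ℱ m]` converge a.s., as the memory
`m → ∞`, to the continuation kernel `p_μ(past ω)(B)`. [folklore] -/
theorem ae_tendsto_condExp_pastFiltration (μ : Measure (ℤ → Site 2)) [IsFiniteMeasure μ]
    {B : Set (Site 2)} (hB : MeasurableSet B) :
    ∀ᵐ ω ∂μ, Tendsto (fun m => (μ[((fun ω : ℤ → Site 2 => ω 1) ⁻¹' B).indicator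
      (fun _ => (1 : ℝ)) | pastFiltration m]) ω) atTop
        (𝓝 (((continuationKernel μ) (past ω)).real B)) := by
  have h1 := tendsto_ae_condExp (μ := μ) (ℱ := pastFiltration)
    (((fun ω : ℤ → Site 2 => ω 1) ⁻¹' B).indicator (fun _ => (1 : ℝ)))
  rw [iSup_pastFiltration] at h1
  filter_upwards [h1, continuationKernel_ae_eq_condExp μ hB] with ω hω hω'
  rw [hω']; exact hω

/-- Almost every atom of a countably-valued random variable has positive mass. [folklore] -/
theorem ae_map_apply_singleton_ne_zero {β : Type*} [MeasurableSpace β]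
    [MeasurableSingletonClass β] [Countable β] (μ : Measure (ℤ → Site 2))
    {X : (ℤ → Site 2) → β} (hX : Measurable X) :
    ∀ᵐ ω ∂μ, μ.map X {X ω} ≠ 0 := by
  rw [ae_iff]
  have hset : {ω | ¬μ.map X {X ω} ≠ 0} = X ⁻¹' {x | μ.map X {x} = 0} := by
    ext ω; simp
  rw [hset, ← Measure.map_apply hX (Set.to_countable _).measurableSet,
    ← Set.biUnion_of_singleton {x | μ.map X {x} = 0},
    measure_biUnion_null_iff (Set.to_countable _)]
  exact fun x hx => hx

/-- **The finite-memory conditional probability is the elementary ratio of cylinder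
probabilities**: `μ[𝟙{ω 1 ∈ B} | ℱ m](ω) = μ (E_m(ω) ∩ {ω 1 ∈ B}) / μ (E_m(ω))` for a.e. `ω`,
where `E_m(ω) = pastCyl m (past ω)` is the atom of `ω` in `ℱ m`. [folklore] -/
theorem condExp_pastFiltration_ae_eq_cond (μ : Measure (ℤ → Site 2)) [IsFiniteMeasure μ]
    (m : ℕ) {B : Set (Site 2)} (hB : MeasurableSet B) :
    μ[((fun ω : ℤ → Site 2 => ω 1) ⁻¹' B).indicator (fun _ => (1 : ℝ)) | pastFiltration m]
      =ᵐ[μ] fun ω => ((μ[|pastCyl m (past ω)]) ((fun ω : ℤ → Site 2 => ω 1) ⁻¹' B)).toReal := by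
  have hX := measurable_pastWindow m
  have h1 := condDistrib_ae_eq_condExp (μ := μ) hX measurable_apply_one hB
  rw [← pastFiltration_eq_comap] at h1
  filter_upwards [h1, ae_map_apply_singleton_ne_zero μ hX] with ω hω hne
  rw [← hω, measureReal_def, condDistrib_apply_of_ne_zero measurable_apply_one _ hne,
    Measure.map_apply hX (measurableSet_singleton _),
    Measure.map_apply (hX.prodMk measurable_apply_one) ((measurableSet_singleton _).prod hB),
    mk_preimage_prod, preimage_pastWindow_singleton,
    cond_apply (measurableSet_pastCyl m (past ω))]

/-- **The continuation kernel is the a.s. limit of the finite-memory continuation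
probabilities** — `p_μ(past ω)(B) = lim_{m → ∞} μ (E_m(ω) ∩ {ω 1 ∈ B}) / μ (E_m(ω))` for
`μ`-a.e. `ω`, `E_m(ω) = {ω' | ω' (-j) = ω (-j), j ≤ m}`: Lawler's `Q(ω ⊕ s)/Q(ω)` on growing
finite pasts converges to the kernel on the infinite past (Lévy's upward theorem + the
elementary formula on atoms). [folklore] -/
theorem ae_tendsto_cond_pastCyl (μ : Measure (ℤ → Site 2)) [IsFiniteMeasure μ]
    {B : Set (Site 2)} (hB : MeasurableSet B) :
    ∀ᵐ ω ∂μ, Tendsto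
      (fun m => ((μ[|pastCyl m (past ω)]) ((fun ω : ℤ → Site 2 => ω 1) ⁻¹' B)).toReal)
      atTop (𝓝 (((continuationKernel μ) (past ω)).real B)) := by
  have h2 : ∀ᵐ ω ∂μ, ∀ m,
      (μ[((fun ω : ℤ → Site 2 => ω 1) ⁻¹' B).indicator (fun _ => (1 : ℝ)) |
        pastFiltration m]) ω =
        ((μ[|pastCyl m (past ω)]) ((fun ω : ℤ → Site 2 => ω 1) ⁻¹' B)).toReal :=
    ae_all_iff.mpr fun m => condExp_pastFiltration_ae_eq_cond μ m hB
  filter_upwards [ae_tendsto_condExp_pastFiltration μ hB, h2] with ω hω hω'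
  simpa only [hω'] using hω

/-- Singleton form: **`p_μ(s | past ω) = lim_m μ[ω' 1 = s | ω' = ω on [-m, 0]]` a.s.**
[cite: LawlerSchrammWerner2004SAW, §3.4.6] -/
theorem ae_tendsto_cond_pastCyl_stepProb (μ : Measure (ℤ → Site 2)) [IsFiniteMeasure μ]
    (s : Site 2) :
    ∀ᵐ ω ∂μ, Tendsto (fun m => ((μ[|pastCyl m (past ω)]) {ω' | ω' 1 = s}).toReal)
      atTop (𝓝 (stepProb μ (past ω) s)) :=
  ae_tendsto_cond_pastCyl μ (measurableSet_singleton s)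

/-! ### Support of the kernel: admissible continuations -/

/-- The **admissible continuations** of a past `η = (η 0, η 1, …)` (root `η 0`): lattice
neighbours of the root not visited by the past. [cite: LawlerSchrammWerner2004SAW, §3.4.6] -/
def admissible (η : ℕ → Site 2) : Set (Site 2) :=
  {s | (zdGraph 2).Adj (η 0) s ∧ ∀ j : ℕ, s ≠ η j}

/-- The graph of `admissible` is a measurable subset of `(ℕ → ℤ²) × ℤ²`. [folklore] -/
theorem measurableSet_admissibleGraph :
    MeasurableSet {p : (ℕ → Site 2) × Site 2 | p.2 ∈ admissible p.1} := by
  have h1 : MeasurableSet {p : (ℕ → Site 2) × Site 2 | (zdGraph 2).Adj (p.1 0) p.2} := by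
    have : {p : (ℕ → Site 2) × Site 2 | (zdGraph 2).Adj (p.1 0) p.2} =
        (fun p : (ℕ → Site 2) × Site 2 => (p.1 0, p.2)) ⁻¹'
          {x : Site 2 × Site 2 | (zdGraph 2).Adj x.1 x.2} := rfl
    rw [this]
    exact ((measurable_pi_apply 0).comp measurable_fst).prodMk measurable_snd
      (Set.to_countable _).measurableSet
  have h2 : MeasurableSet {p : (ℕ → Site 2) × Site 2 | ∀ j : ℕ, p.2 ≠ p.1 j} := by
    have : {p : (ℕ → Site 2) × Site 2 | ∀ j : ℕ, p.2 ≠ p.1 j} =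
        ⋂ j : ℕ, {p : (ℕ → Site 2) × Site 2 | p.2 = p.1 j}ᶜ := by
      ext p; simp
    rw [this]
    exact MeasurableSet.iInter fun j =>
      (measurableSet_eq_fun measurable_snd ((measurable_pi_apply j).comp measurable_fst)).compl
  simpa [admissible, setOf_and] using h1.inter h2

/-- **The continuation kernel of a two-sided SAW law is carried by the admissible
continuations**: for `μ`-a.e. `ω`, `p_μ(past ω)` gives full mass to the neighbours of the root
not visited by the past (nearest-neighbour steps and self-avoidance pass to the kernel).
[cite: LawlerSchrammWerner2004SAW, §3.4.6] -/
theorem KestenTwoSidedSAW.ae_continuationKernel_admissible {μ : Measure (ℤ → Site 2)}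
    [IsFiniteMeasure μ] (h : KestenTwoSidedSAW μ) :
    ∀ᵐ ω ∂μ, continuationKernel μ (past ω) (admissible (past ω)) = 1 := by
  set S := {p : (ℕ → Site 2) × Site 2 | p.2 ∈ admissible p.1} with hS
  have hSm : MeasurableSet S := measurableSet_admissibleGraph
  -- the joint law of (past, next vertex) = (μ.map past) ⊗ₘ kernel is carried by `S`
  have hcp : ∀ᵐ x ∂((μ.map past) ⊗ₘ continuationKernel μ), x ∈ S := by
    rw [continuationKernel, compProd_map_condDistrib measurable_apply_one.aemeasurable]
    refine (ae_map_iff (measurable_past.prodMk measurable_apply_one).aemeasurable hSm).mpr ?_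
    filter_upwards [h.ae_isTwoSidedSAW] with ω hω
    obtain ⟨-, hinj, hadj⟩ := hω
    simp only [mem_setOf_eq, admissible, past_apply, Nat.cast_zero, neg_zero]
    refine ⟨by simpa using hadj 0, fun j hj => ?_⟩
    have := hinj hj
    omega
  -- disintegrate along `past`
  have hae : ∀ᵐ η ∂(μ.map past), continuationKernel μ η (admissible η) = 1 := by
    filter_upwards [Measure.ae_ae_of_ae_compProd hcp] with η hη
    rw [← prob_compl_eq_zero_iff (Set.to_countable _).measurableSet,
      measure_eq_zero_iff_ae_notMem]
    filter_upwards [hη] with s hs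
    simpa [hS] using hs
  exact ae_of_ae_map measurable_past.aemeasurable hae

end Literature.Probability.RandomPlanarGeometry.SAW
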